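import Literature.MathematicalPhysics.QuantumManyBody.McMillanAllenDynes

/-!
# The Allen–Dynes `T_c` is monotone in the shape ratio `r = ω̄₂/ω_log` (for `1 ≤ r ≤ 2`)

`Literature/MathematicalPhysics/QuantumManyBody/McMillanAllenDynes.lean` proves the box → band
statement for the Allen–Dynes formula at FIXED shape ratio `r = ω̄₂/ω_log`
(`allenDynesTc_mem_Icc_of_mem_box`). In a screening pipeline the members of a numerical box (several
smearings, grid levels, q-partners) carry slightly different `r` (typically `1.05–1.4`), so the corner
rule actually used is the one on the FOUR-parameter box `[ω₋, ω₊] × [r₋, r₊] × [λ₋, λ₊] × [μ₋, μ₊]`.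
This file supplies the missing monotonicity: Allen–Dynes' shape factor
`f₂ = 1 + (r − 1) λ² / (λ² + Λ₂²)`, `Λ₂ = 1.82 (1 + 6.3 μ*) r` [AllenDynes1975, Eqs. (36), (38)] is
monotone INCREASING in `r` on `1 ≤ r ≤ 2` (elementary: with `c = 1.82(1 + 6.3μ*)`,
`∂_r [(r−1)/(λ² + c²r²)] = (λ² + c² r (2 − r)) / (λ² + c² r²)² ≥ 0` there; the algebraic form used
below is `(r₁−1) r₂² − (r₂−1) r₁² = (r₂ − r₁)((r₁−1)(r₂−1) − 1) ≤ 0`), hence so is `T_c^{AD}`, and the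
four-parameter box maps into the band between the corners `(ω₋, r₋, λ₋, μ₊)` and `(ω₊, r₊, λ₊, μ₋)`.
The restriction `r ≤ 2` is harmless (Jensen gives `r ≥ 1`; phonon spectra of real materials have
`r ≲ 1.5`) and is where the sign of the derivative is parameter-free; no claim is made beyond it.

## References
* [AllenDynes1975] P. B. Allen, R. C. Dynes, Phys. Rev. B 12 (1975) 905 — Eqs. (34)–(38).
-/

noncomputable section

namespace Literature.MathematicalPhysics.QuantumManyBody

/-- Algebraic core: for `0 < c`, `0 ≤ λ` and `1 ≤ r₁ ≤ r₂ ≤ 2`,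
`(r₁ − 1)/(λ² + (c r₁)²) ≤ (r₂ − 1)/(λ² + (c r₂)²)`. [folklore] -/
private theorem shape_quot_mono {c lam r₁ r₂ : ℝ} (hc : 0 < c) (hr₁ : 1 ≤ r₁) (h : r₁ ≤ r₂)
    (hr₂ : r₂ ≤ 2) :
    (r₁ - 1) / (lam ^ 2 + (c * r₁) ^ 2) ≤ (r₂ - 1) / (lam ^ 2 + (c * r₂) ^ 2) := by
  have hcr₁ : 0 < c * r₁ := mul_pos hc (by linarith)
  have hcr₂ : 0 < c * r₂ := mul_pos hc (by linarith)
  have hd₁ : 0 < lam ^ 2 + (c * r₁) ^ 2 := by positivity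
  have hd₂ : 0 < lam ^ 2 + (c * r₂) ^ 2 := by positivity
  rw [div_le_div_iff₀ hd₁ hd₂]
  -- (r₁-1)(λ²+c²r₂²) ≤ (r₂-1)(λ²+c²r₁²)
  have hkey : (r₁ - 1) * r₂ ^ 2 - (r₂ - 1) * r₁ ^ 2 = (r₂ - r₁) * ((r₁ - 1) * (r₂ - 1) - 1) := by
    ring
  have hprod : (r₁ - 1) * (r₂ - 1) ≤ 1 := by nlinarith
  have hneg : (r₁ - 1) * r₂ ^ 2 - (r₂ - 1) * r₁ ^ 2 ≤ 0 := by
    rw [hkey]; exact mul_nonpos_iff.mpr (Or.inl ⟨by linarith, by linarith⟩)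
  have hc2 : 0 ≤ c ^ 2 := sq_nonneg c
  nlinarith [mul_nonpos_iff.mpr (Or.inr ⟨hneg, hc2⟩), sq_nonneg lam, mul_nonneg (sq_nonneg lam) (sub_nonneg.2 h)]

/-- **`f₂` is monotone increasing in the shape ratio** `r = ω̄₂/ω_log` on `1 ≤ r ≤ 2`
(any real `λ`, `μ* ≥ 0`). [cite: AllenDynes1975, Eq. (36)] -/
theorem allenDynesF2_mono_r {lam mu r₁ r₂ : ℝ} (hmu : 0 ≤ mu) (hr₁ : 1 ≤ r₁)
    (h : r₁ ≤ r₂) (hr₂ : r₂ ≤ 2) : allenDynesF2 lam mu r₁ ≤ allenDynesF2 lam mu r₂ := by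
  unfold allenDynesF2 allenDynesLambda2
  have hc : 0 < 1.82 * (1 + 6.3 * mu) := by positivity
  have key := shape_quot_mono (lam := lam) hc hr₁ h hr₂
  -- rewrite both sides as 1 + λ² · (r-1)/(λ² + (c r)²)
  have e : ∀ r : ℝ, (r - 1) * (lam ^ 2 / (lam ^ 2 + (1.82 * (1 + 6.3 * mu) * r) ^ 2)) =
      lam ^ 2 * ((r - 1) / (lam ^ 2 + (1.82 * (1 + 6.3 * mu) * r) ^ 2)) := fun r => by ring
  rw [e r₁, e r₂]
  have := mul_le_mul_of_nonneg_left key (sq_nonneg lam)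
  linarith

/-- **`T_c^{AD}` is monotone increasing in the shape ratio `r`** on `1 ≤ r ≤ 2` at fixed
`(ω_log, λ, μ*)` in the physical domain (`0 ≤ ω_log`, `0 ≤ λ`, `0 ≤ μ*`).
[cite: AllenDynes1975, Eq. (34)] -/
theorem allenDynesTc_mono_r {omegaLog lam mu r₁ r₂ : ℝ} (hω : 0 ≤ omegaLog) (hlam : 0 ≤ lam)
    (hmu : 0 ≤ mu) (hr₁ : 1 ≤ r₁) (h : r₁ ≤ r₂) (hr₂ : r₂ ≤ 2) :
    allenDynesTc omegaLog r₁ lam mu ≤ allenDynesTc omegaLog r₂ lam mu := by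
  unfold allenDynesTc
  have hF2 := allenDynesF2_mono_r (lam := lam) hmu hr₁ h hr₂
  have hF1 : 0 ≤ allenDynesF1 lam mu := (allenDynesF1_pos hlam hmu).le
  have hT : 0 ≤ mcMillanTc omegaLog lam mu := mcMillanTc_nonneg lam mu hω
  have := mul_le_mul_of_nonneg_left hF2 hF1
  exact mul_le_mul_of_nonneg_right this hT

/-- **Box → band on the four-parameter box.** If `(ω_log, r, λ, μ*)` ranges over
`[ω₋, ω₊] × [r₋, r₊] × [λ₋, λ₊] × [μ₋, μ₊]` with `0 ≤ ω₋`, `1 ≤ r₋`, `r₊ ≤ 2`, `0 ≤ λ₋`, `0 ≤ μ₋`,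
`0.62 μ₊ ≤ 1` and a positive McMillan denominator at the worst corner `(λ₋, μ₊)`, then `T_c^{AD}` lies
between its values at the corners `(ω₋, r₋, λ₋, μ₊)` and `(ω₊, r₊, λ₊, μ₋)` — the corner rule as a
screening pipeline applies it when the box members carry different `ω̄₂/ω_log`.
[cite: AllenDynes1975, Eq. (34)] -/
theorem allenDynesTc_mem_Icc_of_mem_box4 {ωlo ωhi rlo rhi llo lhi mlo mhi ω r lam mu : ℝ}
    (hωlo : 0 ≤ ωlo) (hrlo : 1 ≤ rlo) (hrhi : rhi ≤ 2) (hllo : 0 ≤ llo) (hmlo : 0 ≤ mlo)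
    (hmhi : 0.62 * mhi ≤ 1) (hD : 0 < mcMillanDenom llo mhi)
    (hω : ω ∈ Set.Icc ωlo ωhi) (hr : r ∈ Set.Icc rlo rhi) (hl : lam ∈ Set.Icc llo lhi)
    (hm : mu ∈ Set.Icc mlo mhi) :
    allenDynesTc ω r lam mu ∈ Set.Icc (allenDynesTc ωlo rlo llo mhi) (allenDynesTc ωhi rhi lhi mlo) := by
  obtain ⟨hr₁, hr₂⟩ := hr
  have hr1 : 1 ≤ r := hrlo.trans hr₁
  have hr2 : r ≤ 2 := hr₂.trans hrhi
  -- fixed-r box at this r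
  have hbox := allenDynesTc_mem_Icc_of_mem_box hωlo hllo hmlo hmhi hr1 hD hω hl hm
  obtain ⟨hlo, hhi⟩ := hbox
  have hmhi0 : 0 ≤ mhi := hmlo.trans (hm.1.trans hm.2)
  have hlhi : 0 ≤ lhi := hllo.trans (hl.1.trans hl.2)
  have hωhi : 0 ≤ ωhi := hωlo.trans (hω.1.trans hω.2)
  constructor
  · exact (allenDynesTc_mono_r hωlo hllo hmhi0 hrlo hr₁ hr2).trans hlo
  · exact hhi.trans (allenDynesTc_mono_r hωhi hlhi hmlo hr1 hr₂ hrhi)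

end Literature.MathematicalPhysics.QuantumManyBody

end
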